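import Summits.QuantumFields.BalabanUV.T4Continuum.Support.NE9TorusIneq229Chain

/-!
# UVStable030TorusChain — surge node T09.1 ON THE TORUS with the BLOCK-CHAIN tree-decay input: [I] Theorem 1 ⟹ ultraviolet stability
# (0.30) with the constant `O(1)·(2²⁰ + 2⁵Γ₄³e^{−(κ−κ₁)})·(1 − L^{−α})^{−1}` for every `κ ≥ κ₁(4) + 1` (`κ₁(4) < 80`), and `O(1)·(2²⁰ + 1)·(1 − L^{−α})^{−1}`
# from `κ ≥ 144` — in place of `TreeLengthTorus.uvStable030_of_thm1_torus`'s `O(1)·K₀(64,8)·(1 − L^{−α})^{−1}`, `K₀(64,8) = 162⁶⁴/81 ∈ (10¹³⁹, 10¹⁴⁰)`,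
# `κ ≥ κ₀(64,8) = 64·log 162 ≈ 325.6` (cell `pub-balaban`, surge node T09.1 / census rows S-B13.13, S-B13.24; T4-DAG §6 rows NE9 ∕ NE5 lane
# «geometry of record»; NE9 formalisation swarm LEAF PROVER 05, lineage leaf-05, generation 4; part E of the lineage item «(1.26) direct on the
# torus model by a block-chain discretisation» — parts A `NE9TreeBlockChain` p212919, B1∕B2 `NE9TorusIneq126Chain(Sum)` p213115∕p213318,
# C `NE9RecordIneq126Chain` p213514, D `NE9TorusIneq229Chain` p213657)

HONEST FRAMING (T4-DAG PAGE 1).  Rung (B)+1 of the FINITE-VOLUME T⁴ programme — existence AND uniqueness of the ε → 0 limit of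
gauge-invariant observables on a fixed torus; NOT infinite volume, NOT a mass gap, NOT the Clay problem.  This file touches the cell's
reproduction chain of [I] (0.30) (ultraviolet stability on the torus, surge node T09.1): Theorem 1 of [I] (`B12.Thm1Printed`) and the three
readings `h023`∕`h028`∕`h029` of `Repr` REMAIN HYPOTHESES exactly as in `TreeLengthTorus.uvStable030_of_thm1_torus` — nothing of [I] is proved or
asserted here (ABSOLUTE RULE); only the cell's certified CONSTANT of the silent tree-decay input (1.26) moves.  NE9 NOT PRINTED ∕ NOT PROVED;
spine 0/9 unchanged; 0/18 leaves instantiated on Bałaban's objects.  HONEST DEPENDENCY (cell line, verbatim): continuum YM on T⁴ ⇐ BetaPertH ∧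
nine spine estimates (0/9 proved); BetaPertH ⇐ (D1) ∧ (D4) ∧ CAP+tail; G-an2-4 gates asym, D1 and NE2/3/4.  `FlowStep.BetaPertH`, (B), (B^μ)
do not occur here.

WHY.  `B12.uvStable030_of_thm1` (surge node T09.1) takes the tree-decay input `hTree : ∀ P j □, Σ_{X ∈ above □} e^{−κ d_j(X)} ≤ K` with an
ARBITRARY `K ≥ 0` and returns (0.30) with the constant `O(1)·K·(1 − L^{−α})^{−1}`; unit pv22's torus corollary feeds it with the volume-leaf
`K = K₀(64,8)` at `κ ≥ κ₀(64,8)`.  THIS FILE feeds it with part D's `ineq126Printed_chain` instead (kernel, no new definition, no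
`def … : Prop`, 0 sorry; `B12.uvStable030_of_thm1`, `TreeLengthTorus.card_tcube_eq_inv_pow` BY NAME):
* `hTree_chain_torus`: the `hTree` shape on the torus system at `(κ, 2^d·2^(2^d) + 2^{d+1}Γ_d³·e^{−(κ−κ₁(d))})`, `κ ≥ κ₁(d) + 1`;
* **`uvStable030_of_thm1_torus_chain`**: `TreeLengthTorus.uvStable030_of_thm1_torus` token for token with `hκ : kappa₀ (4·2^4) (2·4) ≤ κ` REPLACED
  by `hκ : kappa₁ 4 + 1 ≤ κ` and the constant `K₀ (4·2^4) (2·4)` by `2²⁰ + 2⁵·Γ₄³·e^{−(κ − κ₁(4))}`;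
* **`uvStable030_of_thm1_torus_chain_144`**: for `κ ≥ 144` the constant is `O(1)·(2²⁰ + 1)·(1 − L^{−α})^{−1}` (part B2: `κ₁(4) < 80`, `2⁵Γ₄³ < e⁶⁴`;
  monotonicity of `B12.UVStable030`'s constant is NOT assumed — the `hTree` bound is weakened to `2²⁰ + 1` before the composition).
DISGUISE TEST: pure composition of T09.1 with a geometric count; every analytic input of (0.30) stays displayed.

References (TYPES only): T. Bałaban, *Renormalization group approach to lattice gauge field theories. I*, Commun. Math. Phys. **109**, 249–301
(1987) [Balaban1987RG1], (0.26) p. 257, (0.30) pp. 258–259 (quoted in the tree modules `B12`, `B12TreeDecay`, `TreeLengthTorus`); *II*,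
Commun. Math. Phys. **116**, 1–22 (1988) [Balaban1988RG2Cluster], (1.26) p. 8.  Summits-side NEW work (LEAN PLACEMENT RULE); imports part D
only; modifies nothing.  Value = the certified constant of the cell's torus UV-stability chain brought from `K₀(64,8) ≈ 10^{139.5}` (κ ≥ 325.6) to
`2²⁰ + 1` (κ ≥ 144), NOT summit progress and NOT a proof of anything in [I].
-/

noncomputable section

open scoped BigOperators

namespace Summit.QuantumFields.BalabanUV.T4Continuum.UVStable030TorusChain

open Literature.MathematicalPhysics.QuantumFieldTheory.Balaban1983to89
open Literature.MathematicalPhysics.QuantumFieldTheory.Balaban1983to89.TreeLengthTorus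
open Summit.QuantumFields.BalabanUV.T4Continuum.NE9TorusIneq126Chain (chainConst kappa₁ chainConst_pos)
open Summit.QuantumFields.BalabanUV.T4Continuum.NE9TorusIneq126ChainSum (kappa₁_four_lt socketConst_four_lt_exp)
open Summit.QuantumFields.BalabanUV.T4Continuum.NE9TorusIneq229Chain (ineq126Printed_chain)

/-- The silent input `hTree` of [I] (0.26)/(0.30) for the cover induced by the torus system, BLOCK-CHAIN CONSTANT: for `κ ≥ κ₁(d) + 1`,
`∀ □, Σ_{X ∈ above □} e^{−κ d_j(X)} ≤ 2^d·2^(2^d) + 2^{d+1}Γ_d³·e^{−(κ−κ₁(d))}` (part D's `ineq126Printed_chain`, definitionally the `hTree` shape —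
cf. `TreeLengthTorus.hTree_torus` at `(κ₀(4·2^d, 2d), K₀(4·2^d, 2d))`). [cite: Balaban1987RG1, (0.26) p.257 and (0.30) p.258] -/
theorem hTree_chain_torus (d N : ℕ) [NeZero N] {κ : ℝ} (hκ : kappa₁ d + 1 ≤ κ) :
    ∀ c : (tcubeSys d N).toCubeCover.Cube,
      ∑ X ∈ (tcubeSys d N).toCubeCover.above c, Real.exp (-κ * (tsys d N).dj X)
        ≤ 2 ^ d * 2 ^ (2 ^ d) + 2 ^ (d + 1) * chainConst d ^ 3 * Real.exp (-(κ - kappa₁ d)) :=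
  ineq126Printed_chain d N hκ

/-- **T09.1 ON THE TORUS, BLOCK-CHAIN CONSTANT** — `TreeLengthTorus.uvStable030_of_thm1_torus` (d = 4) token for token with the tree-decay
threshold `κ₀(64, 8) = 64·log 162` REPLACED by `κ₁(4) + 1` (`< 81`) and the constant `K₀(64, 8) = 162⁶⁴/81` by `2²⁰ + 2⁵·Γ₄³·e^{−(κ−κ₁(4))}`:
Theorem 1 (`B12.Thm1Printed`) ⟹ ultraviolet stability (0.30) (`B12.UVStable030`) with the constant
`O(1)·(2²⁰ + 2⁵Γ₄³e^{−(κ−κ₁(4))})·(1 − L^{−α})^{−1}`; the readings `h023`, `h028`, `h029` of `Repr`, the tiling identity `hnum` and the site counts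
`hSites` exactly as there.  Pure composition of `B12.uvStable030_of_thm1` with `hTree_chain_torus`. [cite: Balaban1987RG1, (0.30) p.258 and p.259] -/
theorem uvStable030_of_thm1_torus_chain (C : B12.Construction) (O1 α κ M L : ℝ) (Nc : B12.RunParams → ℕ → ℕ)
    [∀ P j, NeZero (Nc P j)]
    (hO1 : 0 ≤ O1) (hα : 0 < α) (hM : 0 < M) (hL : 1 < L) (hκ : kappa₁ 4 + 1 ≤ κ)
    (Etot : (P : B12.RunParams) → (k : ℕ) → (C P).Cfg k → ℕ → ℝ)
    (VX : (P : B12.RunParams) → (k : ℕ) → (C P).Cfg k → (j : ℕ) → (tsys 4 (Nc P j)).Dom → ℝ)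
    (h1 : B12.Thm1Printed C)
    (h023 : ∀ P k, (C P).Repr k → ∀ V, V ∈ (C P).dom k →
      B12.Sum023Printed ((C P).Ek k V) ((C P).wilsonBG k V) (fun j => (C P).flow.β j ((C P).flow.g (j - 1)))
        (Etot P k V) k)
    (h028 : ∀ P k, (C P).Repr k → ∀ V, V ∈ (C P).dom k → ∀ j ∈ Finset.Icc 1 k,
      B12.Sum028Printed ((C P).flow.β j ((C P).flow.g (j - 1))) ((C P).wilsonBG k V) (Etot P k V j) (VX P k V j))
    (h029 : ∀ P k, (C P).Repr k → ∀ V, V ∈ (C P).dom k → ∀ j ∈ Finset.Icc 1 k,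
      B12.Bound029Printed (VX P k V j) O1 L ((L ^ k)⁻¹) α κ j)
    (hnum : ∀ P j, ((C P).numSites j : ℝ) = (M * (Nc P j : ℝ)) ^ 4)
    (hSites : ∀ P j k, j ≤ k → k ≤ P.K →
      ((C P).numSites j : ℝ) = (L ^ (k - j)) ^ 4 * ((C P).numSites k : ℝ)) :
    ∃ γ : ℝ, 0 < γ ∧ B12.UVStable030 C γ
      (O1 * (2 ^ 20 + 2 ^ 5 * chainConst 4 ^ 3 * Real.exp (-(κ - kappa₁ 4))) * (1 - L ^ (-α))⁻¹) M := by
  have hK : (0 : ℝ) ≤ 2 ^ 20 + 2 ^ 5 * chainConst 4 ^ 3 * Real.exp (-(κ - kappa₁ 4)) := by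
    have := chainConst_pos 4
    positivity
  have h16 : (2 : ℝ) ^ 4 * 2 ^ (2 ^ 4) + 2 ^ (4 + 1) * chainConst 4 ^ 3 * Real.exp (-(κ - kappa₁ 4))
      = 2 ^ 20 + 2 ^ 5 * chainConst 4 ^ 3 * Real.exp (-(κ - kappa₁ 4)) := by norm_num
  exact B12.uvStable030_of_thm1 C O1 α κ _ M L hO1 hα hK hM hL (fun P j => tsys 4 (Nc P j))
    (fun P j => (tcubeSys 4 (Nc P j)).toCubeCover) Etot VX h1 h023 h028 h029
    (fun P j c => by have h := hTree_chain_torus 4 (Nc P j) hκ c; rwa [h16] at h)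
    (fun P j => by rw [hnum P j]; exact card_tcube_eq_inv_pow 4 (Nc P j) hM.ne') hSites

/-- **THE CORNER `κ ≥ 144`**: Theorem 1 ⟹ (0.30) on the torus with the constant `O(1)·(2²⁰ + 1)·(1 − L^{−α})^{−1}` for every `κ ≥ 144` (the
tree-decay input weakened to `Σ_{X ∈ above □} e^{−κ d_j(X)} ≤ 2²⁰ + 1` by part B2's numerals `κ₁(4) < 80`, `2⁵Γ₄³ < e⁶⁴`, then T09.1) — versus
`O(1)·K₀(64,8)·(1 − L^{−α})^{−1}`, `K₀(64,8) ∈ (10¹³⁹, 10¹⁴⁰)`, for `κ ≥ 64·log 162 ≈ 325.6` in `TreeLengthTorus.uvStable030_of_thm1_torus`.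
[cite: Balaban1987RG1, (0.30) p.258 and p.259] -/
theorem uvStable030_of_thm1_torus_chain_144 (C : B12.Construction) (O1 α κ M L : ℝ) (Nc : B12.RunParams → ℕ → ℕ)
    [∀ P j, NeZero (Nc P j)]
    (hO1 : 0 ≤ O1) (hα : 0 < α) (hM : 0 < M) (hL : 1 < L) (hκ : 144 ≤ κ)
    (Etot : (P : B12.RunParams) → (k : ℕ) → (C P).Cfg k → ℕ → ℝ)
    (VX : (P : B12.RunParams) → (k : ℕ) → (C P).Cfg k → (j : ℕ) → (tsys 4 (Nc P j)).Dom → ℝ)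
    (h1 : B12.Thm1Printed C)
    (h023 : ∀ P k, (C P).Repr k → ∀ V, V ∈ (C P).dom k →
      B12.Sum023Printed ((C P).Ek k V) ((C P).wilsonBG k V) (fun j => (C P).flow.β j ((C P).flow.g (j - 1)))
        (Etot P k V) k)
    (h028 : ∀ P k, (C P).Repr k → ∀ V, V ∈ (C P).dom k → ∀ j ∈ Finset.Icc 1 k,
      B12.Sum028Printed ((C P).flow.β j ((C P).flow.g (j - 1))) ((C P).wilsonBG k V) (Etot P k V j) (VX P k V j))
    (h029 : ∀ P k, (C P).Repr k → ∀ V, V ∈ (C P).dom k → ∀ j ∈ Finset.Icc 1 k,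
      B12.Bound029Printed (VX P k V j) O1 L ((L ^ k)⁻¹) α κ j)
    (hnum : ∀ P j, ((C P).numSites j : ℝ) = (M * (Nc P j : ℝ)) ^ 4)
    (hSites : ∀ P j k, j ≤ k → k ≤ P.K →
      ((C P).numSites j : ℝ) = (L ^ (k - j)) ^ 4 * ((C P).numSites k : ℝ)) :
    ∃ γ : ℝ, 0 < γ ∧ B12.UVStable030 C γ (O1 * (2 ^ 20 + 1) * (1 - L ^ (-α))⁻¹) M := by
  have hk := kappa₁_four_lt
  have hκ' : kappa₁ 4 + 1 ≤ κ := by linarith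
  have htail : (2 : ℝ) ^ (4 + 1) * chainConst 4 ^ 3 * Real.exp (-(κ - kappa₁ 4)) ≤ 1 := by
    have h1 : Real.exp (-(κ - kappa₁ 4)) ≤ Real.exp (-64) := Real.exp_le_exp.2 (by linarith)
    have h2 := socketConst_four_lt_exp
    have h3 : (0 : ℝ) ≤ 2 ^ (4 + 1) * chainConst 4 ^ 3 := by
      have := chainConst_pos 4
      positivity
    calc (2 : ℝ) ^ (4 + 1) * chainConst 4 ^ 3 * Real.exp (-(κ - kappa₁ 4))
        ≤ 2 ^ (4 + 1) * chainConst 4 ^ 3 * Real.exp (-64) := mul_le_mul_of_nonneg_left h1 h3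
      _ ≤ Real.exp 64 * Real.exp (-64) := mul_le_mul_of_nonneg_right h2.le (Real.exp_pos _).le
      _ = 1 := by rw [← Real.exp_add]; norm_num
  have hTree : ∀ (P : B12.RunParams) (j : ℕ) (c : (tcubeSys 4 (Nc P j)).toCubeCover.Cube),
      ∑ X ∈ (tcubeSys 4 (Nc P j)).toCubeCover.above c, Real.exp (-κ * (tsys 4 (Nc P j)).dj X) ≤ 2 ^ 20 + 1 := by
    intro P j c
    refine (hTree_chain_torus 4 (Nc P j) hκ' c).trans ?_
    have h20 : (2 : ℝ) ^ 4 * 2 ^ (2 ^ 4) = 2 ^ 20 := by norm_num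
    rw [h20]
    linarith
  exact B12.uvStable030_of_thm1 C O1 α κ (2 ^ 20 + 1) M L hO1 hα (by positivity) hM hL (fun P j => tsys 4 (Nc P j))
    (fun P j => (tcubeSys 4 (Nc P j)).toCubeCover) Etot VX h1 h023 h028 h029 hTree
    (fun P j => by rw [hnum P j]; exact card_tcube_eq_inv_pow 4 (Nc P j) hM.ne') hSites

end Summit.QuantumFields.BalabanUV.T4Continuum.UVStable030TorusChain

end
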